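import Literature.MathematicalPhysics.QuantumFieldTheory.Balaban1983to89.B9SectBH1ReadWriteY
import Literature.MathematicalPhysics.QuantumFieldTheory.Balaban1983to89.Node00.OpsYRead342Cross
import Literature.MathematicalPhysics.QuantumFieldTheory.Balaban1983to89.B9Eq340CovariantLipschitzY

/-!
# `Balaban1983to89.B9SectBH1ProbesY` — the PAIR PROBES of the (3.43) Hölder reading as real-linear functionals, their bridges to the letters of the tree's
# Sect. B frames, and the three probe READS a letters-level (3.43) frame instance needs in U-LETTERS: the two printed words at general `𝔸`-valued inputs,
# the RIGHT-FORWARD CROSS word `ζηG′∇_{U,μ}`, and the UNDIFFERENTIATED word `ζη²G′` (covariant Lipschitz inside a block)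

T. Bałaban, *Propagators for lattice gauge theories in a background field*, Commun. Math. Phys. **99** (1985) 389–434
[`Balaban1985BackgroundPropagators`, "B9"]; [4] = T. Bałaban, *Propagators and renormalization transformations for lattice gauge
theories. II*, Commun. Math. Phys. **96** (1984) 223–250 [`Balaban1984PropagatorsII`].

statement-level skeleton of published theorems with citation tags; proofs where landed; nothing here is a claim about the
Yang–Mills mass gap

THE PRINTED LOCI.  (3.40) p. 397 (the covariant Hölder quotient `|R(U(Γ_{x,x′}))λ(x′) − λ(x)| ∕ |x − x′|^α`); (3.43) p. 398 (`‖ζ∇_UG′(U)λ‖_β`,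
`‖ζG′(U)∇*_Uλ‖_β ≦ B₀(β)(Lʲη)^{1−β}(‖ζ‖_β + |ζ|)e^{−δ₀d(y,y′)}|λ|`); (3.42) p. 397 (the sup entries); Theorem 3.4 p. 400 and p. 403 l. 1–9 (the same bounds for
`G′(U′U)` «of course with different constants», the letters `∇_U`, `U(Γ)` of the base `U`); (3.3) p. 390, (3.8) p. 392 with (3.5) p. 391 (`∇_μ = −∇*_μ∘T_μ`,
`T_μ` the covariant forward transport-shift); [4] (2.51)–(2.52) p. 232 (block majorants, block pieces), Lemma 2.1 p. 234 + (2.59) p. 233 (finitely many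
blocks near a block above an `M`-threshold), (2.1) p. 224 (`η = L^{−k}`, blocks `B^j(y)` of side `Lʲη`).

WHY THIS FILE (seat dag-n06-c gen 12; pub-ymgap N06 row 13 under R13-U1, the (3.43) member of `B9SectBCodedReadingsU.SectBStepU`).  The letters-level Sect.-B
frame for (3.43) (`B9SectBGpStepAtLettersV2.H1Frame₂.h1_transfer`, r06's per-PROBE Hölder transfers) speaks of real-linear functionals `Φ` of the
`𝔸`-valued output applied to `coord⁻¹(D(G′μ))` for block-supported real coordinate vectors `μ`; def-Y's reading `hLatS` ∕ dag-n06-c's `h1ReadT` speaks of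
the sup of pair quotients of the ζ-localised words.  THIS FILE is the dictionary between the two and the three reads an instance must supply:
* §1 ★ `probeH par α ζ z z′` — THE PAIR-PROBE FUNCTIONAL `X ↦ (η|z′−z|_T)^{−α}·(R(U(Γ_{z,z′}))(ζ(z′)X(z′)) − ζ(z)X(z))` (ℝ-linear), `norm_probeH` (its norm IS
  the pair quotient `quotS`), `wordS_eq_smul` ∕ `quotS_wordS_eq` (the (3.43) words are `ζ·(ηWΛ)`);
* §2 the COORDINATE BRIDGES: `symm_conj_apply` and the four letter composites of the frames read back as def-Y words (`symm_conj_G`,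
  `symm_gradF_G` = `η∇_{U,μ}Tg`, `symm_G_negGradB` = `−ηT∇*_{U,μ}g`, `symm_G_gradF` = `ηT∇_{U,μ}g`, for `G = η²T`);
* §3 geometry: `pdist_le_of_blkY_eq` (two sites of one block are within `Lʲη`), `cutH_inl_nonneg`;
* §4 ★ READ OF THE TWO PRINTED WORDS at a general input `coord⁻¹μ = Σ_j μ_j ⊗ b_j` from reading bounds (`quotL_symm_le`, `quotR_symm_le`; p631070 §6);
* §5 ★★ `quotRF_cross_liftY_le` ∕ `quotRF_cross_symm_le` — THE RIGHT-FORWARD CROSS WORD `ζηT∇_{U,μ}(f ⊗ E)`: `∇_μ = −∇*_μ∘T_μ`, the transported amplitude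
  split into its block pieces over the radius-`2(d+1)` neighbourhood of the input block (template: def-Y's `OpsYRead342Cross.eta_mul_norm_O_cdS_le_of_eBlock`,
  with the pair quotient in place of the sup), each piece read by the printed right word;
* §6 `HolderLipY` (def) — THE DISPLAYED LAW on the transporter: covariant Lipschitz INSIDE A BLOCK, `‖R(par z z′)Ψ(z′) − Ψ(z)‖ ≦ c_Lip·η⁻¹·(η|z′−z|_T)·
  sup_{w ∈ Δ, μ}‖(∇_{U,μ}Ψ)(w)‖` for `z, z′` in one block `Δ` (for def-Y's `parSymY` this is dag-n06-c's `B9Eq340CovariantLipschitzY.quot_parSymY_le_of_rungwise`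
  once the taxi rungs of a block are shown to stay in the block — not done here);
* §7 ★★ `quot_undiff_le` — THE UNDIFFERENTIATED PROBE `ζ·Ψ` (`Ψ = η²G′g`): `quot ≦ ‖ζ‖_α·A₀ + |ζ|·c_Lip·η⁻¹·(Lʲη)^{1−α}·A₁` from a block sup `A₀` of `Ψ`, a block
  sup `A₁` of its covariant differences, the flat Hölder seminorm of `ζ` and `HolderLipY` (r06's right-transfer premise (a′) with `(Lʲη)^{2−β}`).
HONEST SCOPE.  Elementary bookkeeping (linearity, triangle inequalities, finite sums, `Real.rpow` monotonicity) over def-Y's and dag-n06-c's landed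
definitions; the transporter law is a named HYPOTHESIS, not proved; nothing of [B9] asserted; COUNT-NEUTRAL; N06 NOT discharged; one finite lattice
programme at fixed ε — nothing continuum, nothing about OS positivity or the mass gap.
-/

noncomputable section

namespace Literature.MathematicalPhysics.QuantumFieldTheory.Balaban1983to89.B9SectBH1ProbesY

open B9Eq39Adjoint (R R_smul R_zero R_sub R_add)
open B6KLevelCensusIndexV1 (KIdx kGeo)
open B6Ineq2142KLevelV1 (β)
open B6Geom246MultiLevelBox (blkOf coord_bounds)
open B4TorusKernel.MultiPeriod (torusSupNorm torusSupNorm_nonneg circAbs_le_abs)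
open B6Prop22KLevelTorusCensusEta (nKT nKT_pos hqTP hqTP_nonneg pair_le_hqTP)
open B6RandomWalk (HasMajorant BlockSupp)
open B9Thm34Ext (toB6)
open B9GeoNormsKLevelV1 (geo9K)
open B9Ineq349SiteComposite (cdSL cdsSL cdSL_apply cdsSL_apply etaS_pos norm_le_norm_mul_of_ball)
open B9Eq352DivFormLetters (conj coordEquiv coordEquiv_symm_apply gradLetterF gradLetterB)
open B9Eq310Hermitian (norm_R_le)
open B9SectBGpLettersY (blkC stencilF_blkC)
open B9RWSumsReadsNbr (nbr mem_nbr)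
open B9GeoLemma21KLevelV1 (geo9K_dist_comm geo9K_dist_triangle)
open B9Eq360DeltaPrimeAY (blkY)
open Node00 (SiteY BlkY IBondY CfgY BallY liftY liftY_apply hqS hLatS etaS cdS cdsS cdsS_smul UboxY shiftY supBlkS' toKT)
open Node00.OpsYHolderFar (pdist denS denS_nonneg pdist_nonneg pair_le_hqS hqS_le_of_forall one_le_NB)
open Node00.OpsYRead342 (gradF_mul_apply mul_neg_gradB_apply abs_le_supNorm_inl geo9K_len_congr geo9K_dist_congr liftY_smul_right norm_le_supBlkS')
open Node00.OpsYRead342Cross (cdS_eq_neg_cdsS_transport transport_liftY_eq_sum mul_gradF_apply)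
open B9SectBH1ReadWriteY (wordS quotS h1ReadT quotS_nonneg quotS_smul quotS_sum_le wordS_add wordS_smul wordS_sum quotL_sum_le_of_h1ReadT
  quotR_sum_le_of_h1ReadT quotR_le_h1ReadT h1ReadT_nonneg)

variable {d ℓ : ℕ} {hd : 1 ≤ d + 1} {hL : Odd (ℓ + 1) ∧ 1 < ℓ + 1} {b₀ b₁ : ℝ}
variable {𝔸 : Type} [NormedRing 𝔸] [NormedAlgebra ℂ 𝔸] [CompleteSpace 𝔸]
variable (i : KIdx d ℓ hd hL b₀ b₁)

/-! ## §1 The pair-probe functional -/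

/-- ★ **THE PAIR-PROBE FUNCTIONAL** of (3.40)∕(3.43) at the pair `(z, z′)`, cut-off `ζ`, exponent `α`, transporter `par`:
`X ↦ (η|z′−z|_T)^{−α}·(R(par z z′)(ζ(z′)X(z′)) − ζ(z)X(z))` — a REAL-linear functional of the `𝔸`-valued site function `X` (the `Φ` of r06's per-probe
Hölder transfers). [cite: Balaban1985BackgroundPropagators, (3.40) p.397, (3.43) p.398] -/
def probeH (par : SiteY i → SiteY i → 𝔸ˣ) (α : ℝ) (ζ : SiteY i → ℝ) (z z' : SiteY i) : (SiteY i → 𝔸) →ₗ[ℝ] 𝔸 where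
  toFun X := (denS i α z z')⁻¹ • (R (par z z') (((ζ z' : ℝ) : ℂ) • X z') - ((ζ z : ℝ) : ℂ) • X z)
  map_add' X Y := by
    simp only [Pi.add_apply, smul_add, R_add, add_sub_add_comm]
  map_smul' r X := by
    simp only [Pi.smul_apply, RingHom.id_apply]
    rw [smul_comm (((ζ z' : ℝ) : ℂ)) r (X z'), smul_comm (((ζ z : ℝ) : ℂ)) r (X z), R_smul, ← smul_sub,
      smul_comm r ((denS i α z z')⁻¹)]

omit [CompleteSpace 𝔸] in
/-- `probeH` applied. [cite: Balaban1985BackgroundPropagators, (3.40) p.397, bookkeeping] -/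
theorem probeH_apply (par : SiteY i → SiteY i → 𝔸ˣ) (α : ℝ) (ζ : SiteY i → ℝ) (z z' : SiteY i) (X : SiteY i → 𝔸) :
    probeH i par α ζ z z' X = (denS i α z z')⁻¹ • (R (par z z') (((ζ z' : ℝ) : ℂ) • X z') - ((ζ z : ℝ) : ℂ) • X z) := rfl

omit [CompleteSpace 𝔸] in
/-- ★ **THE NORM OF THE PROBE IS THE PAIR QUOTIENT** of the ζ-localised function `w ↦ ζ(w)X(w)`. [cite: Balaban1985BackgroundPropagators, (3.40) p.397, (3.43) p.398] -/
theorem norm_probeH (par : SiteY i → SiteY i → 𝔸ˣ) (α : ℝ) (ζ : SiteY i → ℝ) (z z' : SiteY i) (X : SiteY i → 𝔸) :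
    ‖probeH i par α ζ z z' X‖ = quotS i par α (fun w => ((ζ w : ℝ) : ℂ) • X w) z z' := by
  rw [probeH_apply, norm_smul, Real.norm_eq_abs, abs_of_nonneg (inv_nonneg.2 (denS_nonneg i α z z'))]
  simp only [quotS, div_eq_inv_mul]

omit [CompleteSpace 𝔸] in
/-- the (3.43) word `ζη·WΛ` is the ζ-localisation of `η·WΛ`. [cite: Balaban1985BackgroundPropagators, (3.43) p.398, bookkeeping] -/
theorem wordS_eq_smul (ζ : SiteY i → ℝ) (W : (SiteY i → 𝔸) →ₗ[ℂ] (SiteY i → 𝔸)) (Λ : SiteY i → 𝔸) :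
    wordS i ζ W Λ = fun w => ((ζ w : ℝ) : ℂ) • ((((etaS i : ℝ) : ℂ)) • W Λ) w := by
  funext w
  simp only [wordS, Pi.smul_apply, Complex.ofReal_mul, mul_smul]

omit [CompleteSpace 𝔸] in
/-- ★ the pair quotient of a (3.43) word is the norm of the probe at `η·WΛ`. [cite: Balaban1985BackgroundPropagators, (3.40) p.397, (3.43) p.398] -/
theorem quotS_wordS_eq (par : SiteY i → SiteY i → 𝔸ˣ) (α : ℝ) (ζ : SiteY i → ℝ) (W : (SiteY i → 𝔸) →ₗ[ℂ] (SiteY i → 𝔸)) (Λ : SiteY i → 𝔸)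
    (z z' : SiteY i) : quotS i par α (wordS i ζ W Λ) z z' = ‖probeH i par α ζ z z' ((((etaS i : ℝ) : ℂ)) • W Λ)‖ := by
  rw [norm_probeH, wordS_eq_smul]

omit [CompleteSpace 𝔸] in
/-- the pair quotient is invariant under negation of the word. [cite: Balaban1985BackgroundPropagators, (3.40) p.397, bookkeeping] -/
theorem quotS_neg (par : SiteY i → SiteY i → 𝔸ˣ) (α : ℝ) (Ψ : SiteY i → 𝔸) (z z' : SiteY i) :
    quotS i par α (-Ψ) z z' = quotS i par α Ψ z z' := by
  have h := quotS_smul i par α (-1 : ℝ) Ψ z z'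
  rwa [neg_one_smul, abs_neg, abs_one, one_mul] at h

/-! ## §2 The coordinate bridges: the frames' letter composites read back as def-Y words -/

section Bridges

variable {ι : Type} [Fintype ι] (b : Module.Basis ι ℝ 𝔸)

omit [CompleteSpace 𝔸] in
/-- `coord⁻¹(conj b T v) = T(coord⁻¹ v)`. [cite: Balaban1984PropagatorsII, (2.51) p.232, bookkeeping] -/
theorem symm_conj_apply (T : Module.End ℝ (SiteY i → 𝔸)) (v : SiteY i × ι → ℝ) :
    (coordEquiv b).symm (conj b T v) = T ((coordEquiv b).symm v) := by
  rw [conj, LinearEquiv.conj_apply_apply, LinearEquiv.symm_apply_apply]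

omit [CompleteSpace 𝔸] in
/-- `coord⁻¹μ = Σ_j μ(·,j) ⊗ b_j`. [cite: Balaban1984PropagatorsII, (2.51) p.232, bookkeeping] -/
theorem coordEquiv_symm_eq_sum_liftY (μ : SiteY i × ι → ℝ) : (coordEquiv b).symm μ = ∑ j, liftY (fun w => μ (w, j)) (b j) := by
  funext w
  rw [coordEquiv_symm_apply, Finset.sum_apply]
  refine Finset.sum_congr rfl fun j _ => ?_
  rw [liftY_apply, Complex.coe_smul]

variable (T : (SiteY i → 𝔸) →ₗ[ℂ] (SiteY i → 𝔸)) (U : CfgY 𝔸 i)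

/-- the frames' `G′`-letter before conjugation: `η²·T` as a real operator. [cite: Balaban1985BackgroundPropagators, (3.25) p.394, (3.42) p.397 (lattice units), bookkeeping] -/
abbrev Gsc : Module.End ℝ (SiteY i → 𝔸) := (etaS i ^ 2) • T.restrictScalars ℝ

omit [CompleteSpace 𝔸] in
/-- `Gsc` applied. [cite: Balaban1985BackgroundPropagators, (3.42) p.397, bookkeeping] -/
theorem Gsc_apply (Λ : SiteY i → 𝔸) : Gsc i T Λ = (etaS i ^ 2) • T Λ := rfl

omit [CompleteSpace 𝔸] in
/-- bridge 0: `coord⁻¹(conj b (η²T) μ) = η²·T(coord⁻¹μ)`. [cite: Balaban1985BackgroundPropagators, (3.42) p.397; Balaban1984PropagatorsII, (2.51) p.232] -/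
theorem symm_conj_G (μ : SiteY i × ι → ℝ) :
    (coordEquiv b).symm (conj b (Gsc i T) μ) = ((((etaS i ^ 2 : ℝ)) : ℂ)) • T ((coordEquiv b).symm μ) := by
  rw [symm_conj_apply, Gsc_apply, Complex.coe_smul]

/-- bridge 1 (LEFT forward letter): `coord⁻¹((conj b (η⁻¹∇_μ-letter) * conj b (η²T)) μ) = η·∇_{U,μ}(T(coord⁻¹μ))`.
[cite: Balaban1985BackgroundPropagators, (3.43) p.398 («ζ∇_UG′λ»), (3.3) p.390; Balaban1984PropagatorsII, (2.51)–(2.52) p.232] -/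
theorem symm_gradF_G (ν : Fin (d + 1)) (μ : SiteY i × ι → ℝ) :
    (coordEquiv b).symm ((conj b (gradLetterF (shiftY i) (UboxY i U) ((((etaS i : ℝ) : ℂ))⁻¹) ν) * conj b (Gsc i T)) μ)
      = (((etaS i : ℝ) : ℂ)) • cdS i U ν (T ((coordEquiv b).symm μ)) := by
  rw [← B9Eq352DivFormLetters.conj_mul, symm_conj_apply]
  funext w
  rw [Pi.smul_apply]
  exact gradF_mul_apply i (fun _ => T) U (Gsc i T) (fun Λ => rfl) ν _ w

/-- bridge 2 (RIGHT backward letter): `coord⁻¹((conj b (η²T) * conj b (−η⁻¹∇*_μ-letter)) μ) = −η·T(∇*_{U,μ}(coord⁻¹μ))`.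
[cite: Balaban1985BackgroundPropagators, (3.43) p.398 («ζG′∇*_Uλ»), (3.8) p.392; Balaban1984PropagatorsII, (2.51)–(2.52) p.232] -/
theorem symm_G_negGradB (ν : Fin (d + 1)) (μ : SiteY i × ι → ℝ) :
    (coordEquiv b).symm ((conj b (Gsc i T) * conj b (-gradLetterB (shiftY i) (UboxY i U) ((((etaS i : ℝ) : ℂ))⁻¹) ν)) μ)
      = -((((etaS i : ℝ) : ℂ)) • T (cdsS i U ν ((coordEquiv b).symm μ))) := by
  rw [← B9Eq352DivFormLetters.conj_mul, symm_conj_apply]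
  funext w
  rw [Pi.neg_apply, Pi.smul_apply]
  exact mul_neg_gradB_apply i (fun _ => T) U (Gsc i T) (fun Λ => rfl) ν _ w

/-- bridge 3 (RIGHT forward letter, the cross orientation): `coord⁻¹((conj b (η²T) * conj b (η⁻¹∇_μ-letter)) μ) = η·T(∇_{U,μ}(coord⁻¹μ))`.
[cite: Balaban1985BackgroundPropagators, (3.3) p.390, (3.42) p.397 (not a printed orientation); Balaban1984PropagatorsII, (2.51)–(2.52) p.232] -/
theorem symm_G_gradF (ν : Fin (d + 1)) (μ : SiteY i × ι → ℝ) :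
    (coordEquiv b).symm ((conj b (Gsc i T) * conj b (gradLetterF (shiftY i) (UboxY i U) ((((etaS i : ℝ) : ℂ))⁻¹) ν)) μ)
      = (((etaS i : ℝ) : ℂ)) • T (cdS i U ν ((coordEquiv b).symm μ)) := by
  rw [← B9Eq352DivFormLetters.conj_mul, symm_conj_apply]
  funext w
  rw [Pi.smul_apply]
  exact mul_gradF_apply i (fun _ => T) U (Gsc i T) (fun Λ => rfl) ν _ w

end Bridges

/-! ## §3 Geometry: two sites of one block; nonnegativity of the cut-off norm -/

omit [NormedRing 𝔸] [NormedAlgebra ℂ 𝔸] [CompleteSpace 𝔸] in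
/-- ★ **TWO SITES OF ONE BLOCK ARE WITHIN `Lʲη`**: `η|z′ − z|_T ≦ L^{j}·η` for `z, z′ ∈ B^j(y)` (the block is a cube of `Lʲ` lattice points per direction).
[cite: Balaban1984PropagatorsII, (2.1) p.224 («B^j(y)», «η = L^{−k}»); Balaban1985BackgroundPropagators, (3.40) p.397] -/
theorem pdist_le_of_blkY_eq {z z' : SiteY i} (h : blkY i z' = blkY i z) :
    pdist i z z' ≤ (((ℓ + 1 : ℕ) : ℝ)) ^ (blkY i z).1.1 * etaS i := by
  have hn := nKT_pos (toKT i)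
  unfold pdist
  rw [show etaS i = ((((nKT (toKT i) : ℕ) : ℝ)))⁻¹ from rfl, ← div_eq_mul_inv]
  refine div_le_div_of_nonneg_right ?_ hn.le
  refine Finset.sup'_le _ _ fun ν _ => ?_
  obtain ⟨h1, h2⟩ := coord_bounds i.D.toDomains (show blkOf i.D.toDomains z = blkY i z from rfl) ν
  obtain ⟨h1', h2'⟩ := coord_bounds i.D.toDomains (show blkOf i.D.toDomains z' = blkY i z from h) ν
  have hab : |(z'.1 - z.1) ν| ≤ (((ℓ + 1) ^ (blkY i z).1.1 : ℕ) : ℤ) := by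
    rw [Pi.sub_apply, abs_le]; constructor <;> linarith
  have h3 : B4TorusKernel.MultiPeriod.circAbs ((toKT i).NB ν) ((z'.1 - z.1) ν) ≤ (((ℓ + 1) ^ (blkY i z).1.1 : ℕ) : ℤ) :=
    (circAbs_le_abs (one_le_NB i ν) _).trans hab
  exact_mod_cast h3

omit [NormedRing 𝔸] [NormedAlgebra ℂ 𝔸] [CompleteSpace 𝔸] in
/-- the (3.43) cut-off norm `‖ζ‖_α + |ζ|` of a site cut-off is nonnegative. [cite: Balaban1985BackgroundPropagators, (3.43) p.398, bookkeeping] -/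
theorem cutH_inl_nonneg (α : ℝ) (ζ : SiteY i → ℝ) : 0 ≤ (geo9K i).cutH α (Sum.inl ζ) := by
  show 0 ≤ hqTP (toKT i) α ζ + (toKT i).supF ζ
  refine add_nonneg (hqTP_nonneg (toKT i) α ζ) ?_
  exact le_ciSup_of_le (Set.finite_range fun x : SiteY i => |ζ x|).bddAbove (toKT i).origin (abs_nonneg _)

omit [NormedRing 𝔸] [NormedAlgebra ℂ 𝔸] [CompleteSpace 𝔸] in
/-- the cut-off norm unfolded: `cutH α (inl ζ) = ‖ζ‖_α + |ζ|`. [cite: Balaban1985BackgroundPropagators, (3.43) p.398, bookkeeping] -/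
theorem cutH_inl_eq (α : ℝ) (ζ : SiteY i → ℝ) : (geo9K i).cutH α (Sum.inl ζ) = hqTP (toKT i) α ζ + (toKT i).supF ζ := rfl

omit [NormedRing 𝔸] [NormedAlgebra ℂ 𝔸] [CompleteSpace 𝔸] in
/-- `|ζ(w)| ≤ |ζ|`. [cite: Balaban1985BackgroundPropagators, (3.43) p.398, bookkeeping] -/
theorem abs_le_supF (ζ : SiteY i → ℝ) (w : SiteY i) : |ζ w| ≤ (toKT i).supF ζ :=
  le_ciSup (Set.finite_range fun x : SiteY i => |ζ x|).bddAbove w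

omit [NormedRing 𝔸] [NormedAlgebra ℂ 𝔸] [CompleteSpace 𝔸] in
/-- the flat Hölder pair bound with the (3.40) denominator: `|ζ(z′) − ζ(z)| ≤ ‖ζ‖_α·(η|z′−z|_T)^α`, `z ≠ z′`.
[cite: Balaban1984PropagatorsII, (2.67) p.234 («‖ζ‖_α»); Balaban1985BackgroundPropagators, (3.40) p.397] -/
theorem abs_sub_le_hqTP_mul_denS (α : ℝ) (ζ : SiteY i → ℝ) {z z' : SiteY i} (hne : z ≠ z') (hden : 0 < denS i α z z') :
    |ζ z' - ζ z| ≤ hqTP (toKT i) α ζ * denS i α z z' := by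
  have h := pair_le_hqTP (toKT i) α ζ z z' hne
  have hd : (torusSupNorm (toKT i).NB (z'.1 - z.1) / (nKT (toKT i))) ^ α = denS i α z z' := rfl
  rw [hd, div_le_iff₀ hden] at h
  exact h

/-! ## §4 READ of the two printed words at a general input `coord⁻¹μ` -/

section ReadWords

variable {ι : Type} [Fintype ι] (b : Module.Basis ι ℝ 𝔸) (T : (SiteY i → 𝔸) →ₗ[ℂ] (SiteY i → 𝔸)) (par : SiteY i → SiteY i → 𝔸ˣ) (U : CfgY 𝔸 i)

/-- ★ **READ, LEFT WORD, GENERAL INPUT**: if every coordinate slice `μ(·,j)` has reading `h1ReadT T par U μ_j α ζ ≦ B`, then the pair probe of the left word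
`ζη∇_{U,ν}T(coord⁻¹μ)` is at most `(Σ_j‖b_j‖)·B`. [cite: Balaban1985BackgroundPropagators, (3.43) p.398, (3.40) p.397; Balaban1984PropagatorsII, (2.51)–(2.52) p.232] -/
theorem quotL_symm_le {M₂ : ℝ} (hM₂ : 0 ≤ M₂) (hrepr : ∀ (v : 𝔸) (j : ι), |b.repr v j| ≤ M₂ * ‖v‖) (α : ℝ) (ζ : SiteY i → ℝ)
    (μ : SiteY i × ι → ℝ) {B : ℝ} (hB : ∀ j, h1ReadT i T par U (fun w => μ (w, j)) α ζ ≤ B) (ν : Fin (d + 1)) {z z' : SiteY i} (hne : z ≠ z') :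
    quotS i par α (wordS i ζ (cdSL i U ν ∘ₗ T) ((coordEquiv b).symm μ)) z z' ≤ (∑ j, ‖b j‖) * B := by
  rw [coordEquiv_symm_eq_sum_liftY i b, Finset.sum_mul]
  exact quotL_sum_le_of_h1ReadT i b T par U α ζ hM₂ hrepr (fun j w => μ (w, j)) (fun _ => B) hB ν hne

/-- ★ **READ, RIGHT WORD, GENERAL INPUT.** [cite: Balaban1985BackgroundPropagators, (3.43) p.398, (3.40) p.397; Balaban1984PropagatorsII, (2.51)–(2.52) p.232] -/
theorem quotR_symm_le {M₂ : ℝ} (hM₂ : 0 ≤ M₂) (hrepr : ∀ (v : 𝔸) (j : ι), |b.repr v j| ≤ M₂ * ‖v‖) (α : ℝ) (ζ : SiteY i → ℝ)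
    (μ : SiteY i × ι → ℝ) {B : ℝ} (hB : ∀ j, h1ReadT i T par U (fun w => μ (w, j)) α ζ ≤ B) (ν : Fin (d + 1)) {z z' : SiteY i} (hne : z ≠ z') :
    quotS i par α (wordS i ζ (T ∘ₗ cdsSL i U ν) ((coordEquiv b).symm μ)) z z' ≤ (∑ j, ‖b j‖) * B := by
  rw [coordEquiv_symm_eq_sum_liftY i b, Finset.sum_mul]
  exact quotR_sum_le_of_h1ReadT i b T par U α ζ hM₂ hrepr (fun j w => μ (w, j)) (fun _ => B) hB ν hne

end ReadWords

/-! ## §5 The right-forward cross word `ζηT∇_{U,μ}` -/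

section Cross

variable {ι : Type} [Fintype ι] (b : Module.Basis ι ℝ 𝔸) (ιB : BlkY i → IBondY i) [Fintype (geo9K i).Site]
  (T : (SiteY i → 𝔸) →ₗ[ℂ] (SiteY i → 𝔸)) (par : SiteY i → SiteY i → 𝔸ˣ) (U : CfgY 𝔸 i)

omit [CompleteSpace 𝔸] in
/-- lifts commute with finite sums of the scalar functions. [cite: Balaban1985BackgroundPropagators, (3.39) p.397, bookkeeping] -/
private theorem liftY_finset_sum {X S : Type} (s : Finset S) (h : S → X → ℝ) (E : 𝔸) :
    liftY (∑ a ∈ s, h a) E = ∑ a ∈ s, liftY (h a) E := by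
  classical
  induction s using Finset.induction_on with
  | empty => funext x; simp [liftY_apply]
  | insert a s ha ih =>
    rw [Finset.sum_insert ha, Finset.sum_insert ha, ← ih]
    funext x
    simp only [liftY_apply, Pi.add_apply, Complex.ofReal_add, add_smul]

omit [CompleteSpace 𝔸] in
/-- moving a block by at most `r` costs a factor `e^{|δ|r}` in the decay. [cite: Balaban1984PropagatorsII, (2.54) p.233, bookkeeping] -/
private theorem exp_neg_le_exp_mul_exp_neg {δ r u v : ℝ} (h₁ : u ≤ r + v) (h₂ : v ≤ r + u) :
    Real.exp (-(δ * v)) ≤ Real.exp (|δ| * r) * Real.exp (-(δ * u)) := by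
  rw [← Real.exp_add]
  refine Real.exp_le_exp.2 ?_
  rcases le_or_gt 0 δ with hδ | hδ
  · rw [abs_of_nonneg hδ]; nlinarith
  · rw [abs_of_neg hδ]; nlinarith

/-- ★★ **THE RIGHT-FORWARD CROSS WORD AT AN AMPLITUDE**: from unit norms of the bond variables of `U`, a count `m_N` of the index bonds within `2(d+1)` of a
bond, and reading bounds `h1ReadT T par U g α ζ ≦ W(a)·|g|` for scalar inputs `g` supported in the block of `a` (`a` in the neighbourhood of `y′`, `W(a) ≦ W₀`
there, `W ≧ 0`): the pair probe of `ζη·T∇_{U,ν}(f ⊗ E)` (`supp f ⊂ Δ(βy′)`, `‖E‖ ≦ 1`) is at most `m_N·M₂(Σ_j‖b_j‖)·W₀·|f|` —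
`∇_ν = −∇*_ν∘T_ν`, the transported amplitude split into its block pieces, the printed right word `ζηT∇*_{U,ν}` read on each piece.
[cite: Balaban1985BackgroundPropagators, (3.43) p.398 (second word), (3.3) p.390, (3.8) p.392, (3.40) p.397; Balaban1984PropagatorsII, (2.51)–(2.52) p.232, (2.54) p.233, Lemma 2.1 p.234] -/
theorem quotRF_cross_liftY_le (hι : ∀ s, β i.hN i.D i.hk (ιB s) = s)
    {M₂ : ℝ} (hM₂ : 0 ≤ M₂) (hrepr : ∀ (v : 𝔸) (j : ι), |b.repr v j| ≤ M₂ * ‖v‖)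
    (hU1 : ∀ (μ : Fin (d + 1)) (w : SiteY i), ‖((UboxY i U μ w : 𝔸ˣ) : 𝔸)‖ ≤ 1 ∧ ‖(((UboxY i U μ w)⁻¹ : 𝔸ˣ) : 𝔸)‖ ≤ 1)
    {mN : ℕ} (hnbr : ∀ y' : IBondY i, (nbr (geo9K i) (2 * ((d : ℝ) + 1)) y').card ≤ mN)
    (α : ℝ) (ζ : SiteY i → ℝ) (y' : IBondY i) {W : IBondY i → ℝ} {W₀ : ℝ} (hW0 : ∀ a, 0 ≤ W a)
    (hW : ∀ a ∈ nbr (geo9K i) (2 * ((d : ℝ) + 1)) y', W a ≤ W₀)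
    (hread : ∀ (g : SiteY i → ℝ) (a : IBondY i), (geo9K i).suppIn (Sum.inl g) a → h1ReadT i T par U g α ζ ≤ W a * (geo9K i).supNorm (Sum.inl g))
    (f : SiteY i → ℝ) (hs : (geo9K i).suppIn (Sum.inl f) y') {E : 𝔸} (hE1 : ‖E‖ ≤ 1)
    (ν : Fin (d + 1)) {z z' : SiteY i} (hne : z ≠ z') :
    quotS i par α (wordS i ζ (T ∘ₗ cdSL i U ν) (liftY f E)) z z' ≤
      ((mN : ℝ) * (M₂ * ∑ j, ‖b j‖) * W₀) * (geo9K i).supNorm (Sum.inl f) := by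
  classical
  have hsup : 0 ≤ (geo9K i).supNorm (Sum.inl f) := (abs_nonneg _).trans (abs_le_supNorm_inl i f z)
  have hW₀ : ∀ a ∈ nbr (geo9K i) (2 * ((d : ℝ) + 1)) y', 0 ≤ W₀ := fun a ha => (hW0 a).trans (hW a ha)
  -- the neighbourhood of the input block and the pieces of the transported amplitude
  set Tn : Finset (IBondY i) := nbr (geo9K i) (2 * ((d : ℝ) + 1)) y' with hTn
  set g : ι → SiteY i → ℝ := fun j w => f (shiftY i ν w) * b.repr (R (UboxY i U ν w) E) j with hg
  set gp : ι → IBondY i → SiteY i → ℝ := fun j a w => if blkC i ιB w = a then g j w else 0 with hgp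
  -- (i) where `g_j ≠ 0` the block is in the neighbourhood of `y′`
  have hmemT : ∀ j w, g j w ≠ 0 → blkC i ιB w ∈ Tn := by
    intro j w hw
    have hf : f (shiftY i ν w) ≠ 0 := fun h0 => hw (by simp only [hg, h0, zero_mul])
    have hblk : blkOf i.D.toDomains (shiftY i ν w) = β i.hN i.D i.hk y' := hs _ hf
    have hc : β i.hN i.D i.hk (blkC i ιB (shiftY i ν w)) = β i.hN i.D i.hk y' := by
      show β i.hN i.D i.hk (ιB (blkOf i.D.toDomains (shiftY i ν w))) = _; rw [hι, hblk]
    refine mem_nbr.2 ?_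
    rw [← geo9K_dist_congr i rfl hc]
    exact stencilF_blkC i ιB hι ν w
  -- (ii) `g_j` is the sum of its pieces over the neighbourhood
  have hsplit : ∀ j, g j = ∑ a ∈ Tn, gp j a := by
    intro j; funext w
    rw [Finset.sum_apply]
    show g j w = ∑ a ∈ Tn, (if blkC i ιB w = a then g j w else 0)
    by_cases hw : g j w = 0
    · rw [hw]; symm
      exact Finset.sum_eq_zero fun a _ => ite_self 0
    · rw [Finset.sum_ite_eq, if_pos (hmemT j w hw)]
  -- (iii) the transported amplitude as a double sum of amplitudes
  have hΨ : (fun w => R (UboxY i U ν w) (liftY f E (shiftY i ν w))) = ∑ j, ∑ a ∈ Tn, liftY (gp j a) (b j) := by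
    rw [transport_liftY_eq_sum i b U ν f E]
    refine Finset.sum_congr rfl fun j _ => ?_
    show liftY (g j) (b j) = _
    rw [hsplit j, liftY_finset_sum]
  -- (iv) the word identity `ζηT∇_ν(f ⊗ E) = −Σ_j Σ_a ζηT∇*_ν(g_{j,a} ⊗ b_j)`
  have hword : wordS i ζ (T ∘ₗ cdSL i U ν) (liftY f E) = -(∑ j, ∑ a ∈ Tn, wordS i ζ (T ∘ₗ cdsSL i U ν) (liftY (gp j a) (b j))) := by
    have h1 : wordS i ζ (T ∘ₗ cdSL i U ν) (liftY f E) = wordS i ζ (T ∘ₗ cdsSL i U ν) (-(∑ j, ∑ a ∈ Tn, liftY (gp j a) (b j))) := by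
      funext w
      simp only [wordS, LinearMap.coe_comp, Function.comp_apply, cdSL_apply, cdsSL_apply]
      have hneg : cdsS i U ν (-(∑ j, ∑ a ∈ Tn, liftY (gp j a) (b j))) = -cdsS i U ν (∑ j, ∑ a ∈ Tn, liftY (gp j a) (b j)) :=
        map_neg (cdsSL i U ν) _
      rw [cdS_eq_neg_cdsS_transport i U ν (liftY f E), hΨ, hneg]
    rw [h1, show -(∑ j, ∑ a ∈ Tn, liftY (gp j a) (b j)) = (-1 : ℝ) • (∑ j, ∑ a ∈ Tn, liftY (gp j a) (b j)) by rw [neg_one_smul],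
      wordS_smul, neg_one_smul, wordS_sum]
    congr 1
    exact Finset.sum_congr rfl fun j _ => wordS_sum i _ ζ _ _
  -- (v) each piece: the printed right word at the block `a`, the amplitude `b_j` rescaled into the ball
  have hpiece : ∀ j, ∀ a ∈ Tn, quotS i par α (wordS i ζ (T ∘ₗ cdsSL i U ν) (liftY (gp j a) (b j))) z z'
      ≤ ‖b j‖ * (W₀ * (M₂ * (geo9K i).supNorm (Sum.inl f))) := by
    intro j a haT
    have hsa : (geo9K i).suppIn (Sum.inl (gp j a)) a := by
      intro w hw
      have hwa : blkC i ιB w = a := by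
        by_contra hna
        exact hw (show (if blkC i ιB w = a then g j w else 0) = 0 by rw [if_neg hna])
      show blkOf i.D.toDomains w = β i.hN i.D i.hk a
      rw [← hwa]; show _ = β i.hN i.D i.hk (ιB (blkOf i.D.toDomains w)); rw [hι]
    have hgsup : (geo9K i).supNorm (Sum.inl (gp j a)) ≤ M₂ * (geo9K i).supNorm (Sum.inl f) := by
      refine Real.iSup_le (fun w => ?_) (mul_nonneg hM₂ hsup)
      show |(if blkC i ιB w = a then g j w else 0)| ≤ _
      by_cases hwa : blkC i ιB w = a
      · rw [if_pos hwa]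
        show |f (shiftY i ν w) * b.repr (R (UboxY i U ν w) E) j| ≤ _
        rw [abs_mul]
        have hR : ‖R (UboxY i U ν w) E‖ ≤ 1 := (norm_R_le (hU1 ν w).1 (hU1 ν w).2 E).trans hE1
        calc |f (shiftY i ν w)| * |b.repr (R (UboxY i U ν w) E) j|
            ≤ (geo9K i).supNorm (Sum.inl f) * (M₂ * ‖R (UboxY i U ν w) E‖) :=
              mul_le_mul (abs_le_supNorm_inl i f _) (hrepr _ _) (abs_nonneg _) hsup
          _ ≤ (geo9K i).supNorm (Sum.inl f) * (M₂ * 1) := by gcongr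
          _ = M₂ * (geo9K i).supNorm (Sum.inl f) := by ring
      · rw [if_neg hwa, abs_zero]; exact mul_nonneg hM₂ hsup
    -- the reading bound for the piece, then the probe at the direction `b_j` by homogeneity
    have hreadp : h1ReadT i T par U (gp j a) α ζ ≤ W₀ * (M₂ * (geo9K i).supNorm (Sum.inl f)) :=
      (hread (gp j a) a hsa).trans (mul_le_mul (hW a haT) hgsup ((abs_nonneg _).trans (abs_le_supNorm_inl i _ z)) (hW₀ a haT))
    have hbj : b j ≠ 0 := b.ne_zero j
    have hunit : ‖(‖b j‖⁻¹ • b j : 𝔸)‖ ≤ 1 := by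
      rw [norm_smul, norm_inv, norm_norm, inv_mul_cancel₀ (norm_ne_zero_iff.2 hbj)]
    rw [B9SectBH1ReadWriteY.liftY_eq_norm_smul_unit i (gp j a) hbj, wordS_smul, quotS_smul, abs_norm]
    refine mul_le_mul_of_nonneg_left ?_ (norm_nonneg _)
    exact (quotR_le_h1ReadT i b T par U α ζ hM₂ hrepr (gp j a) ⟨‖b j‖⁻¹ • b j, mem_closedBall_zero_iff.2 hunit⟩ ν hne).trans hreadp
  -- (vi) assemble: the quotient is subadditive, the pieces are at most `m_N·|ι|`-many per direction
  have hcard : ((Tn.card : ℕ) : ℝ) ≤ mN := Nat.cast_le.2 (hnbr y')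
  calc quotS i par α (wordS i ζ (T ∘ₗ cdSL i U ν) (liftY f E)) z z'
      = quotS i par α (∑ j, ∑ a ∈ Tn, wordS i ζ (T ∘ₗ cdsSL i U ν) (liftY (gp j a) (b j))) z z' := by rw [hword, quotS_neg]
    _ ≤ ∑ j, quotS i par α (∑ a ∈ Tn, wordS i ζ (T ∘ₗ cdsSL i U ν) (liftY (gp j a) (b j))) z z' := quotS_sum_le i _ par α _ z z'
    _ ≤ ∑ j, ∑ a ∈ Tn, quotS i par α (wordS i ζ (T ∘ₗ cdsSL i U ν) (liftY (gp j a) (b j))) z z' :=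
        Finset.sum_le_sum fun j _ => quotS_sum_le i _ par α _ z z'
    _ ≤ ∑ j, ∑ a ∈ Tn, ‖b j‖ * (W₀ * (M₂ * (geo9K i).supNorm (Sum.inl f))) :=
        Finset.sum_le_sum fun j _ => Finset.sum_le_sum fun a ha => hpiece j a ha
    _ = (Tn.card : ℝ) * ((∑ j, ‖b j‖) * (W₀ * (M₂ * (geo9K i).supNorm (Sum.inl f)))) := by
        rw [Finset.sum_comm, Finset.sum_const, nsmul_eq_mul, Finset.sum_mul]
    _ ≤ (mN : ℝ) * ((∑ j, ‖b j‖) * (W₀ * (M₂ * (geo9K i).supNorm (Sum.inl f)))) := by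
        refine mul_le_mul_of_nonneg_right hcard (mul_nonneg (Finset.sum_nonneg fun j _ => norm_nonneg _) ?_)
        by_cases hT0 : Tn.Nonempty
        · obtain ⟨a, ha⟩ := hT0
          exact mul_nonneg (hW₀ a ha) (mul_nonneg hM₂ hsup)
        · -- empty neighbourhood: then `W₀` is unconstrained, but the previous sums vanish; bound trivially via `y′ ∈ Tn`
          exfalso
          refine hT0 ⟨y', mem_nbr.2 ?_⟩
          have h0 : (geo9K i).dist y' y' ≤ 2 * ((d : ℝ) + 1) := B9SectBGpLettersY.stencil0_geo9K i y'
          exact h0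
    _ = ((mN : ℝ) * (M₂ * ∑ j, ‖b j‖) * W₀) * (geo9K i).supNorm (Sum.inl f) := by ring

/-- ★★ **THE RIGHT-FORWARD CROSS WORD AT A GENERAL BLOCK-SUPPORTED INPUT** `coord⁻¹μ`, `μ` supported in the (labelled) block `ιB(βy′)` with `|μ| ≦ M`:
the pair probe of `ζη·T∇_{U,ν}(coord⁻¹μ)` is at most `(Σ_j‖b_j‖)·m_N·M₂(Σ_j‖b_j‖)·W₀·M`.
[cite: Balaban1985BackgroundPropagators, (3.43) p.398, (3.3) p.390, (3.8) p.392; Balaban1984PropagatorsII, (2.51)–(2.52) p.232, (2.54) p.233] -/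
theorem quotRF_cross_symm_le (hι : ∀ s, β i.hN i.D i.hk (ιB s) = s)
    {M₂ : ℝ} (hM₂ : 0 ≤ M₂) (hrepr : ∀ (v : 𝔸) (j : ι), |b.repr v j| ≤ M₂ * ‖v‖)
    (hU1 : ∀ (μ : Fin (d + 1)) (w : SiteY i), ‖((UboxY i U μ w : 𝔸ˣ) : 𝔸)‖ ≤ 1 ∧ ‖(((UboxY i U μ w)⁻¹ : 𝔸ˣ) : 𝔸)‖ ≤ 1)
    {mN : ℕ} (hnbr : ∀ y' : IBondY i, (nbr (geo9K i) (2 * ((d : ℝ) + 1)) y').card ≤ mN)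
    (α : ℝ) (ζ : SiteY i → ℝ) (y' : IBondY i) {W : IBondY i → ℝ} {W₀ : ℝ} (hW0 : ∀ a, 0 ≤ W a)
    (hW : ∀ a ∈ nbr (geo9K i) (2 * ((d : ℝ) + 1)) y', W a ≤ W₀)
    (hread : ∀ (g : SiteY i → ℝ) (a : IBondY i), (geo9K i).suppIn (Sum.inl g) a → h1ReadT i T par U g α ζ ≤ W a * (geo9K i).supNorm (Sum.inl g))
    (μ : SiteY i × ι → ℝ) {M : ℝ} (hμ : BlockSupp (g := toB6 (geo9K i) (0 : ℝ) True) (fun p : SiteY i × ι => blkC i ιB p.1) μ y' M)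
    (ν : Fin (d + 1)) {z z' : SiteY i} (hne : z ≠ z') :
    quotS i par α (wordS i ζ (T ∘ₗ cdSL i U ν) ((coordEquiv b).symm μ)) z z' ≤
      (∑ j, ‖b j‖) * (((mN : ℝ) * (M₂ * ∑ j, ‖b j‖) * W₀) * M) := by
  classical
  have hM : 0 ≤ M := hμ.nonneg
  -- the input block is `ιB (β y′)`-labelled iff ... : we only use `off` and `bound` of the block support
  have hy' : ∀ w, blkC i ιB w = y' → β i.hN i.D i.hk y' = blkY i w := by
    intro w hw; rw [← hw]; exact hι _
  rw [coordEquiv_symm_eq_sum_liftY i b, wordS_sum, Finset.sum_mul]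
  refine (quotS_sum_le i _ par α _ z z').trans (Finset.sum_le_sum fun j _ => ?_)
  have hbj : b j ≠ 0 := b.ne_zero j
  have hunit : ‖(‖b j‖⁻¹ • b j : 𝔸)‖ ≤ 1 := by
    rw [norm_smul, norm_inv, norm_norm, inv_mul_cancel₀ (norm_ne_zero_iff.2 hbj)]
  -- the slice `μ_j` is supported in the genuine block `β y′` with `|μ_j| ≦ M`
  have hsj : (geo9K i).suppIn (Sum.inl fun w => μ (w, j)) y' := by
    intro w hw
    by_contra hneq
    exact hw (hμ.off (w, j) fun h => hneq (by rw [← h]; exact (hι _).symm))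
  have hsupj : (geo9K i).supNorm (Sum.inl fun w => μ (w, j)) ≤ M := by
    refine Real.iSup_le (fun w => ?_) hM
    show |μ (w, j)| ≤ M
    by_cases hw : blkC i ιB w = y'
    · exact hμ.bound (w, j) hw
    · rw [hμ.off (w, j) hw, abs_zero]; exact hM
  rw [B9SectBH1ReadWriteY.liftY_eq_norm_smul_unit i (fun w => μ (w, j)) hbj, wordS_smul, quotS_smul, abs_norm]
  refine mul_le_mul_of_nonneg_left ?_ (norm_nonneg _)
  have h := quotRF_cross_liftY_le i b ιB T par U hι hM₂ hrepr hU1 hnbr α ζ y' hW0 hW hread (fun w => μ (w, j)) hsj hunit ν hne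
  refine h.trans (mul_le_mul_of_nonneg_left hsupj ?_)
  have hTne : y' ∈ nbr (geo9K i) (2 * ((d : ℝ) + 1)) y' := mem_nbr.2 (B9SectBGpLettersY.stencil0_geo9K i y')
  exact mul_nonneg (mul_nonneg (Nat.cast_nonneg _) (mul_nonneg hM₂ (Finset.sum_nonneg fun j _ => norm_nonneg _))) ((hW0 y').trans (hW y' hTne))

end Cross

/-! ## §6 The displayed transporter law: covariant Lipschitz inside a block -/

/-- **THE COVARIANT LIPSCHITZ LAW OF A TRANSPORTER INSIDE A BLOCK** (named hypothesis): for two sites `z, z′` of ONE block `Δ`,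
`‖R(par z z′)Ψ(z′) − Ψ(z)‖ ≦ c_Lip·η⁻¹·(η|z′−z|_T)·sup_{w ∈ Δ, μ}‖(∇_{U,μ}Ψ)(w)‖` — the telescoping of the transported difference along the shortest taxi path,
which stays in the cube `Δ`.  For def-Y's `parSymY` this is `B9Eq340CovariantLipschitzY.quot_parSymY_le_of_rungwise` plus the locality of the taxi rungs;
here it is DISPLAYED. [cite: Balaban1985BackgroundPropagators, (3.40) p.397 («U(Γ_{x,x′})»), (3.3) p.390] -/
def HolderLipY (cLip : ℝ) (par : SiteY i → SiteY i → 𝔸ˣ) (U : CfgY 𝔸 i) : Prop :=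
  ∀ (Ψ : SiteY i → 𝔸) (s : BlkY i) (z z' : SiteY i), blkY i z = s → blkY i z' = s →
    ‖R (par z z') (Ψ z') - Ψ z‖ ≤ cLip * (etaS i)⁻¹ * pdist i z z' * supBlkS' i s (fun μ => cdS i U μ Ψ)

/-! ## §7 The undifferentiated probe `ζ·Ψ` -/

section Undiff

variable (par : SiteY i → SiteY i → 𝔸ˣ) (U : CfgY 𝔸 i)

omit [CompleteSpace 𝔸] in
/-- the probe numerator split: `R(p)(ζ(z′)Ψ(z′)) − ζ(z)Ψ(z) = (ζ(z′) − ζ(z))·R(p)Ψ(z′) + ζ(z)·(R(p)Ψ(z′) − Ψ(z))`.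
[cite: Balaban1985BackgroundPropagators, (3.40) p.397, bookkeeping] -/
theorem num_split (p : 𝔸ˣ) (ζ : SiteY i → ℝ) (Ψ : SiteY i → 𝔸) (z z' : SiteY i) :
    R p ((((ζ z' : ℝ) : ℂ)) • Ψ z') - (((ζ z : ℝ) : ℂ)) • Ψ z =
      ((((ζ z' - ζ z : ℝ)) : ℂ)) • R p (Ψ z') + (((ζ z : ℝ) : ℂ)) • (R p (Ψ z') - Ψ z) := by
  rw [R_smul, Complex.ofReal_sub, sub_smul, smul_sub]
  abel

/-- ★★ **THE UNDIFFERENTIATED PROBE** (r06's right-transfer premise (a′) in U-letters): for a site cut-off `ζ` supported in the block `s` (`cutIn`), a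
unitary-type transporter obeying `HolderLipY c_Lip`, and an `𝔸`-valued `Ψ` with `‖Ψ(w)‖ ≦ A₀`, `‖(∇_{U,μ}Ψ)(w)‖`-block-sup `≦ A₁` on `s` (`A₀, A₁, c_Lip ≧ 0`),
`α ≦ 1`: every pair probe of `ζ·Ψ` is at most `‖ζ‖_α·A₀ + |ζ|·c_Lip·η⁻¹·(L^{j(s)}η)^{1−α}·A₁`.
[cite: Balaban1985BackgroundPropagators, (3.40) p.397, (3.43) p.398, (3.42) p.397; Balaban1984PropagatorsII, (2.1) p.224, (2.67) p.234 («‖ζ‖_α + |ζ|»)] -/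
theorem quot_undiff_le {cLip : ℝ} (hcLip : 0 ≤ cLip) (hLip : HolderLipY i cLip par U)
    (hpar : ∀ z z' : SiteY i, ‖((par z z' : 𝔸ˣ) : 𝔸)‖ ≤ 1 ∧ ‖(((par z z')⁻¹ : 𝔸ˣ) : 𝔸)‖ ≤ 1)
    {α : ℝ} (hα1 : α ≤ 1) (ζ : SiteY i → ℝ) (s : BlkY i) (hζ : ∀ w, ζ w ≠ 0 → blkY i w = s)
    (Ψ : SiteY i → 𝔸) {A₀ A₁ : ℝ} (hA₀ : 0 ≤ A₀) (hA₁ : 0 ≤ A₁) (h0 : ∀ w, blkY i w = s → ‖Ψ w‖ ≤ A₀)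
    (h1 : supBlkS' i s (fun μ => cdS i U μ Ψ) ≤ A₁) {z z' : SiteY i} (hne : z ≠ z') :
    quotS i par α (fun w => ((ζ w : ℝ) : ℂ) • Ψ w) z z' ≤
      hqTP (toKT i) α ζ * A₀ + (toKT i).supF ζ * (cLip * (etaS i)⁻¹ * ((((ℓ + 1 : ℕ) : ℝ)) ^ s.1.1 * etaS i) ^ (1 - α) * A₁) := by
  have hη : 0 < etaS i := etaS_pos i
  have hpd : 0 < pdist i z z' := B9Eq340CovariantLipschitzY.pdist_pos_of_ne i hne
  have hden : 0 < denS i α z z' := Real.rpow_pos_of_pos hpd α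
  have hhq := hqTP_nonneg (toKT i) α ζ
  have hsF : 0 ≤ (toKT i).supF ζ := (abs_nonneg _).trans (abs_le_supF i ζ z)
  have hR : ∀ a : 𝔸, ‖R (par z z') a‖ ≤ ‖a‖ := fun a => norm_R_le (hpar z z').1 (hpar z z').2 a
  have hLs : 0 ≤ (((ℓ + 1 : ℕ) : ℝ)) ^ s.1.1 * etaS i := by positivity
  have hT2 : 0 ≤ (toKT i).supF ζ * (cLip * (etaS i)⁻¹ * ((((ℓ + 1 : ℕ) : ℝ)) ^ s.1.1 * etaS i) ^ (1 - α) * A₁) :=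
    mul_nonneg hsF (mul_nonneg (mul_nonneg (mul_nonneg hcLip (inv_nonneg.2 hη.le)) (Real.rpow_nonneg hLs _)) hA₁)
  -- the flat Hölder pair term: `|ζ(z′) − ζ(z)|·‖Ψ(w)‖ ∕ den ≦ ‖ζ‖_α·A₀` for `w ∈ s`
  have hflat : ∀ w, blkY i w = s → |ζ z' - ζ z| * ‖Ψ w‖ / denS i α z z' ≤ hqTP (toKT i) α ζ * A₀ := by
    intro w hw
    rw [div_le_iff₀ hden]
    calc |ζ z' - ζ z| * ‖Ψ w‖ ≤ (hqTP (toKT i) α ζ * denS i α z z') * A₀ :=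
          mul_le_mul (abs_sub_le_hqTP_mul_denS i α ζ hne hden) (h0 w hw) (norm_nonneg _) (mul_nonneg hhq hden.le)
      _ = hqTP (toKT i) α ζ * A₀ * denS i α z z' := by ring
  unfold quotS
  by_cases hz : ζ z = 0
  · -- `z ∉ supp ζ`: the numerator is `ζ(z′)·R(p)Ψ(z′)`
    have hnum : ‖R (par z z') ((((ζ z' : ℝ) : ℂ)) • Ψ z') - (((ζ z : ℝ) : ℂ)) • Ψ z‖ ≤ |ζ z' - ζ z| * ‖Ψ z'‖ := by
      rw [hz, Complex.ofReal_zero, zero_smul, sub_zero, R_smul, norm_smul, Complex.norm_real, Real.norm_eq_abs, sub_zero]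
      exact mul_le_mul_of_nonneg_left (hR _) (abs_nonneg _)
    by_cases hz' : ζ z' = 0
    · have h00 : ‖R (par z z') ((((ζ z' : ℝ) : ℂ)) • Ψ z') - (((ζ z : ℝ) : ℂ)) • Ψ z‖ = 0 := by
        rw [hz, hz', Complex.ofReal_zero, zero_smul, zero_smul, R_zero, sub_zero, norm_zero]
      rw [h00, zero_div]
      exact add_nonneg (mul_nonneg hhq hA₀) hT2
    · exact ((div_le_div_of_nonneg_right hnum hden.le).trans (hflat z' (hζ z' hz'))).trans (le_add_of_nonneg_right hT2)
  · have hzs : blkY i z = s := hζ z hz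
    by_cases hz' : ζ z' = 0
    · -- `z′ ∉ supp ζ`: the numerator is `−ζ(z)Ψ(z)`
      have hnum : ‖R (par z z') ((((ζ z' : ℝ) : ℂ)) • Ψ z') - (((ζ z : ℝ) : ℂ)) • Ψ z‖ ≤ |ζ z' - ζ z| * ‖Ψ z‖ := by
        rw [hz', Complex.ofReal_zero, zero_smul, R_zero, zero_sub, norm_neg, norm_smul, Complex.norm_real, Real.norm_eq_abs, zero_sub,
          abs_neg]
      exact ((div_le_div_of_nonneg_right hnum hden.le).trans (hflat z hzs)).trans (le_add_of_nonneg_right hT2)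
    · -- both in the block: split the numerator, covariant Lipschitz on the second term
      have hz's : blkY i z' = s := hζ z' hz'
      have hpdle : pdist i z z' ≤ (((ℓ + 1 : ℕ) : ℝ)) ^ s.1.1 * etaS i := by
        have h := pdist_le_of_blkY_eq i (z := z) (z' := z') (by rw [hzs, hz's])
        rwa [hzs] at h
      have hnum : ‖R (par z z') ((((ζ z' : ℝ) : ℂ)) • Ψ z') - (((ζ z : ℝ) : ℂ)) • Ψ z‖ ≤
          |ζ z' - ζ z| * ‖Ψ z'‖ + |ζ z| * (cLip * (etaS i)⁻¹ * pdist i z z' * A₁) := by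
        rw [num_split]
        refine (norm_add_le _ _).trans (add_le_add ?_ ?_)
        · rw [norm_smul, Complex.norm_real, Real.norm_eq_abs]
          exact mul_le_mul_of_nonneg_left (hR _) (abs_nonneg _)
        · rw [norm_smul, Complex.norm_real, Real.norm_eq_abs]
          refine mul_le_mul_of_nonneg_left ((hLip Ψ s z z' hzs hz's).trans ?_) (abs_nonneg _)
          exact mul_le_mul_of_nonneg_left h1 (mul_nonneg (mul_nonneg hcLip (inv_nonneg.2 hη.le)) hpd.le)
      refine (div_le_div_of_nonneg_right hnum hden.le).trans ?_
      rw [add_div]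
      refine add_le_add (hflat z' hz's) ?_
      -- `|ζ(z)|·c·η⁻¹·pd·A₁ ∕ pd^α = |ζ(z)|·c·η⁻¹·pd^{1−α}·A₁ ≦ |ζ|·c·η⁻¹·(Lʲη)^{1−α}·A₁`
      have hpow : pdist i z z' / denS i α z z' = pdist i z z' ^ (1 - α) := by
        rw [show denS i α z z' = pdist i z z' ^ α from rfl, Real.rpow_sub hpd, Real.rpow_one]
      have hpow_le : pdist i z z' ^ (1 - α) ≤ ((((ℓ + 1 : ℕ) : ℝ)) ^ s.1.1 * etaS i) ^ (1 - α) :=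
        Real.rpow_le_rpow hpd.le hpdle (by linarith)
      calc |ζ z| * (cLip * (etaS i)⁻¹ * pdist i z z' * A₁) / denS i α z z'
          = |ζ z| * (cLip * (etaS i)⁻¹ * (pdist i z z' / denS i α z z') * A₁) := by
            field_simp
        _ = |ζ z| * (cLip * (etaS i)⁻¹ * pdist i z z' ^ (1 - α) * A₁) := by rw [hpow]
        _ ≤ (toKT i).supF ζ * (cLip * (etaS i)⁻¹ * ((((ℓ + 1 : ℕ) : ℝ)) ^ s.1.1 * etaS i) ^ (1 - α) * A₁) := by
            refine mul_le_mul (abs_le_supF i ζ z) ?_ ?_ hsF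
            · exact mul_le_mul_of_nonneg_right (mul_le_mul_of_nonneg_left hpow_le (mul_nonneg hcLip (inv_nonneg.2 hη.le))) hA₁
            · exact mul_nonneg (mul_nonneg (mul_nonneg hcLip (inv_nonneg.2 hη.le)) (Real.rpow_nonneg hpd.le _)) hA₁

end Undiff

/-! ## §8 Block-support tools: coordinates of amplitudes, values of conjugated letters, the two printed words at block-supported inputs -/

section BlockTools

variable {ι : Type} [Fintype ι] (b : Module.Basis ι ℝ 𝔸) (ιB : BlkY i → IBondY i) [Fintype (geo9K i).Site] {Rr : ℝ} {Hp : Prop}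

omit [CompleteSpace 𝔸] [Fintype (geo9K i).Site] in
/-- `‖(coord⁻¹ v)(w)‖ ≦ (Σ_j‖b_j‖)·C` when every coordinate `|v(w,j)| ≦ C`. [cite: Balaban1984PropagatorsII, (2.51) p.232, bookkeeping] -/
theorem norm_coordEquiv_symm_apply_le (v : SiteY i × ι → ℝ) (w : SiteY i) {C : ℝ} (hC : ∀ j, |v (w, j)| ≤ C) :
    ‖(coordEquiv b).symm v w‖ ≤ (∑ j, ‖b j‖) * C := by
  rw [coordEquiv_symm_apply, Finset.sum_mul]
  refine (norm_sum_le _ _).trans (Finset.sum_le_sum fun j _ => ?_)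
  rw [norm_smul, Real.norm_eq_abs, mul_comm]
  exact mul_le_mul_of_nonneg_left (hC j) (norm_nonneg _)

omit [CompleteSpace 𝔸] in
/-- ★ **VALUES OF A CONJUGATED LETTER FROM ITS BLOCK MAJORANT**: `‖(coord⁻¹(T μ))(w)‖ ≦ (Σ_j‖b_j‖)·K(y(w), y″)·M` for `μ` supported in the labelled block `y″`,
`|μ| ≦ M`. [cite: Balaban1984PropagatorsII, (2.51) p.232 («|(Tλ)(x)| ≤ K(y,y′)|λ|»)] -/
theorem norm_symm_apply_le_of_hasMajorant {Tm : Module.End ℝ (SiteY i × ι → ℝ)} {K : IBondY i → IBondY i → ℝ}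
    (hT : HasMajorant (g := toB6 (geo9K i) Rr Hp) (fun p : SiteY i × ι => blkC i ιB p.1) Tm K)
    {μ : SiteY i × ι → ℝ} {y'' : IBondY i} {M : ℝ} (hμ : BlockSupp (g := toB6 (geo9K i) Rr Hp) (fun p : SiteY i × ι => blkC i ιB p.1) μ y'' M)
    (w : SiteY i) : ‖(coordEquiv b).symm (Tm μ) w‖ ≤ (∑ j, ‖b j‖) * (K (blkC i ιB w) y'' * M) :=
  norm_coordEquiv_symm_apply_le i b (Tm μ) w fun j => hT y'' μ M hμ (w, j)

omit [CompleteSpace 𝔸] in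
/-- ★ **THE COORDINATES OF AN AMPLITUDE ARE BLOCK-SUPPORTED**: for `supp f ⊂ Δ(βy′)` and `‖E‖ ≦ 1`, `coord(f ⊗ E)` is supported in the labelled block
`ιB(βy′)` with `|·| ≦ M₂|f|`. [cite: Balaban1984PropagatorsII, (2.51) p.232; Balaban1985BackgroundPropagators, (3.39) p.397] -/
theorem blockSupp_coordEquiv_liftY {M₂ : ℝ} (hM₂ : 0 ≤ M₂)
    (hrepr : ∀ (v : 𝔸) (j : ι), |b.repr v j| ≤ M₂ * ‖v‖) (f : SiteY i → ℝ) (y' : IBondY i) (hs : (geo9K i).suppIn (Sum.inl f) y')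
    {E : 𝔸} (hE : ‖E‖ ≤ 1) :
    BlockSupp (g := toB6 (geo9K i) Rr Hp) (fun p : SiteY i × ι => blkC i ιB p.1) (coordEquiv b (liftY f E)) (ιB (β i.hN i.D i.hk y'))
      (M₂ * (geo9K i).supNorm (Sum.inl f)) := by
  have hN0 : 0 ≤ (geo9K i).supNorm (Sum.inl f) := (abs_nonneg _).trans (abs_le_supNorm_inl i f (toKT i).origin)
  refine ⟨mul_nonneg hM₂ hN0, fun p _ => ?_, fun p hp => ?_⟩
  · rw [B9Eq352DivFormLetters.coordEquiv_apply, liftY_apply, Complex.coe_smul, map_smul, Finsupp.smul_apply, smul_eq_mul, abs_mul]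
    calc |f p.1| * |b.repr E p.2| ≤ (geo9K i).supNorm (Sum.inl f) * (M₂ * ‖E‖) :=
          mul_le_mul (abs_le_supNorm_inl i f p.1) (hrepr E p.2) (abs_nonneg _) hN0
      _ ≤ (geo9K i).supNorm (Sum.inl f) * M₂ := mul_le_mul_of_nonneg_left (mul_le_of_le_one_right hM₂ hE) hN0
      _ = M₂ * (geo9K i).supNorm (Sum.inl f) := mul_comm _ _
  · have hf : f p.1 = 0 := by
      by_contra hf
      exact hp (congrArg ιB (hs p.1 hf))
    rw [B9Eq352DivFormLetters.coordEquiv_apply, liftY_apply, hf, Complex.ofReal_zero, zero_smul, map_zero, Finsupp.zero_apply]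

variable (T : (SiteY i → 𝔸) →ₗ[ℂ] (SiteY i → 𝔸)) (par : SiteY i → SiteY i → 𝔸ˣ) (U : CfgY 𝔸 i)

omit [Fintype ι] in
/-- the coordinate slices of a block-supported `μ` are supported in the genuine block with `|μ_j| ≦ M`; hence a reading bound for them.
[cite: Balaban1984PropagatorsII, (2.51) p.232, bookkeeping] -/
theorem h1ReadT_slice_le (hι : ∀ s, β i.hN i.D i.hk (ιB s) = s) (α : ℝ) (ζ : SiteY i → ℝ)
    {W : IBondY i → ℝ} (hW0 : ∀ a, 0 ≤ W a)
    (hread : ∀ (g : SiteY i → ℝ) (a : IBondY i), (geo9K i).suppIn (Sum.inl g) a → h1ReadT i T par U g α ζ ≤ W a * (geo9K i).supNorm (Sum.inl g))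
    {μ : SiteY i × ι → ℝ} {y'' : IBondY i} {M : ℝ} (hμ : BlockSupp (g := toB6 (geo9K i) Rr Hp) (fun p : SiteY i × ι => blkC i ιB p.1) μ y'' M)
    (j : ι) : h1ReadT i T par U (fun w => μ (w, j)) α ζ ≤ W y'' * M := by
  have hM : 0 ≤ M := hμ.nonneg
  have hsj : (geo9K i).suppIn (Sum.inl fun w => μ (w, j)) y'' := by
    intro w hw
    by_contra hneq
    exact hw (hμ.off (w, j) fun h => hneq (by rw [← h]; exact (hι _).symm))
  have hsupj : (geo9K i).supNorm (Sum.inl fun w => μ (w, j)) ≤ M := by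
    refine Real.iSup_le (fun w => ?_) hM
    show |μ (w, j)| ≤ M
    by_cases hw : blkC i ιB w = y''
    · exact hμ.bound (w, j) hw
    · rw [hμ.off (w, j) hw, abs_zero]; exact hM
  exact (hread _ y'' hsj).trans (mul_le_mul_of_nonneg_left hsupj (hW0 y''))

/-- ★ **READ, LEFT WORD, BLOCK-SUPPORTED INPUT**: the pair probe of `ζη∇_{U,ν}T(coord⁻¹μ)`, `μ` supported in the labelled block `y″` with `|μ| ≦ M`, is at
most `(Σ_j‖b_j‖)·W(y″)·M` under the reading bounds `h1ReadT T par U g α ζ ≦ W(a)|g|` (`supp g ⊂ Δ(βa)`).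
[cite: Balaban1985BackgroundPropagators, (3.43) p.398 (first word), (3.40) p.397; Balaban1984PropagatorsII, (2.51)–(2.52) p.232] -/
theorem quotL_blockSupp_le (hι : ∀ s, β i.hN i.D i.hk (ιB s) = s) {M₂ : ℝ} (hM₂ : 0 ≤ M₂) (hrepr : ∀ (v : 𝔸) (j : ι), |b.repr v j| ≤ M₂ * ‖v‖)
    (α : ℝ) (ζ : SiteY i → ℝ) {W : IBondY i → ℝ} (hW0 : ∀ a, 0 ≤ W a)
    (hread : ∀ (g : SiteY i → ℝ) (a : IBondY i), (geo9K i).suppIn (Sum.inl g) a → h1ReadT i T par U g α ζ ≤ W a * (geo9K i).supNorm (Sum.inl g))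
    {μ : SiteY i × ι → ℝ} {y'' : IBondY i} {M : ℝ} (hμ : BlockSupp (g := toB6 (geo9K i) Rr Hp) (fun p : SiteY i × ι => blkC i ιB p.1) μ y'' M)
    (ν : Fin (d + 1)) {z z' : SiteY i} (hne : z ≠ z') :
    quotS i par α (wordS i ζ (cdSL i U ν ∘ₗ T) ((coordEquiv b).symm μ)) z z' ≤ (∑ j, ‖b j‖) * (W y'' * M) :=
  quotL_symm_le i b T par U hM₂ hrepr α ζ μ (fun j => h1ReadT_slice_le i ιB T par U hι α ζ hW0 hread hμ j) ν hne

/-- ★ **READ, RIGHT WORD, BLOCK-SUPPORTED INPUT.** [cite: Balaban1985BackgroundPropagators, (3.43) p.398 (second word), (3.40) p.397; Balaban1984PropagatorsII, (2.51)–(2.52) p.232] -/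
theorem quotR_blockSupp_le (hι : ∀ s, β i.hN i.D i.hk (ιB s) = s) {M₂ : ℝ} (hM₂ : 0 ≤ M₂) (hrepr : ∀ (v : 𝔸) (j : ι), |b.repr v j| ≤ M₂ * ‖v‖)
    (α : ℝ) (ζ : SiteY i → ℝ) {W : IBondY i → ℝ} (hW0 : ∀ a, 0 ≤ W a)
    (hread : ∀ (g : SiteY i → ℝ) (a : IBondY i), (geo9K i).suppIn (Sum.inl g) a → h1ReadT i T par U g α ζ ≤ W a * (geo9K i).supNorm (Sum.inl g))
    {μ : SiteY i × ι → ℝ} {y'' : IBondY i} {M : ℝ} (hμ : BlockSupp (g := toB6 (geo9K i) Rr Hp) (fun p : SiteY i × ι => blkC i ιB p.1) μ y'' M)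
    (ν : Fin (d + 1)) {z z' : SiteY i} (hne : z ≠ z') :
    quotS i par α (wordS i ζ (T ∘ₗ cdsSL i U ν) ((coordEquiv b).symm μ)) z z' ≤ (∑ j, ‖b j‖) * (W y'' * M) :=
  quotR_symm_le i b T par U hM₂ hrepr α ζ μ (fun j => h1ReadT_slice_le i ιB T par U hι α ζ hW0 hread hμ j) ν hne

end BlockTools

end Literature.MathematicalPhysics.QuantumFieldTheory.Balaban1983to89.B9SectBH1ProbesY

end
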